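import Mathlib
import Summits.Ventures.PercRepro2.Defs
import Summits.Ventures.PercRepro2.Graph
import Summits.Ventures.PercRepro2.Induced
import Summits.Ventures.PercRepro2.VdBKahn
import Summits.Ventures.PercRepro2.ReimerVdBK
import Summits.Ventures.PercRepro2.ReimerVdBKRegions
import Summits.Ventures.PercRepro2.ReimerVdBKZClosed
import Summits.Ventures.PercRepro2.ReimerVdBKZReduction
import Summits.Ventures.PercRepro2.ReimerVdBKZSplit
import Summits.Ventures.PercRepro2.ReimerVdBKZRecursion
import Summits.Ventures.PercRepro2.ReimerVdBKTypeWeight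
import Summits.Ventures.PercRepro2.ReimerVdBKPairType
import Summits.Ventures.PercRepro2.ReimerVdBKCoreDown
import Summits.Ventures.PercRepro2.ReimerVdBKCoreD
import Summits.Ventures.PercRepro2.ReimerVdBKDegTwoGraph
import Summits.Ventures.PercRepro2.ReimerVdBKDegTwoFlip
import Summits.Ventures.PercRepro2.ReimerVdBKDegTwoExpansion
import Summits.Ventures.PercRepro2.ReimerVdBKLeafGadget
import Summits.Ventures.PercRepro2.ReimerVdBKTwisted
import Summits.Ventures.PercRepro2.ReimerVdBKTied
import Summits.Ventures.PercRepro2.ReimerVdBKDegThreeGraph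

/-!
# The degree-3 expansion, II: (CORE↓) at a vertex of degree 3 follows from the tied Harris and GENSYM3
(blind cell PercRepro2, mine-c g47; `conjectures/MINE-C.md` §56.7 (b), §56.8)

Sorting the colourings of `G` by the colour pattern of the star at an unmarked degree-3 vertex `v`: the two
monochromatic patterns are the tied colourings (`v` never in the core; `count_tied_le` of `ReimerVdBKTied`); the
class «`e_i, e_j` | `e_k`» is the set of colourings of `G⁺_k` with the edge-colour-dependent pin — GENSYM3
(`gensym3Count`, `GenSym3`).  `four_mul_coreCount_deg3`: `4 · coreCount A X B Y {v} = 4 · #(L ∩ tied) +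
Σ_k gensym3Count(G⁺_k)`, and THEOREM `coreDown_of_genSym3`: for a Harris pair, (CORE↓) at `v` follows from
GENSYM3 on the three graphs `G⁺_k`.
-/

namespace Summit.Ventures.PercRepro2
namespace ReimerVdBK
open Classical

variable {V : Type*} {E : Type*} [Fintype E] [DecidableEq E] [Fintype V] [DecidableEq V]
variable (ends : E → Sym2 V) (s : V)

section Defs
variable (A X B Y : Finset V)

/-- The GENSYM3 count of the instance on a graph with the edge `e` and the vertices `a` (an endpoint of `e`) and
`c`: the two-world event weighted by `[e red]·(1 − [a ∈ K₁][c ∈ K₂]) + [e blue]·(1 − [c ∈ K₁][a ∈ K₂])`. -/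
noncomputable def gensym3Count (e : E) (a c : V) : ℕ :=
  ∑ ω : Config E, if ω ∈ twoWorld ends s A X B Y then
    (if ω e = true then (if Conn ends ω s a ∧ Conn ends (compl ω) s c then 0 else 1)
      else (if Conn ends ω s c ∧ Conn ends (compl ω) s a then 0 else 1)) else 0

/-- **GENSYM3`(e; a, c)` for the instance `(A, X; B, Y)`** (left ≤ right; `MINE-C.md` §56.7 (b)). -/
def GenSym3 (e : E) (a c : V) : Prop :=
  gensym3Count ends s A X B Y e a c ≤ gensym3Count ends s (A ∪ B) ∅ ∅ (X ∪ Y) e a c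

end Defs

section Expansion
variable {v u₁ u₂ u₃ : V} {e₁ e₂ e₃ : E} (A X B Y : Finset V)

omit [Fintype E] [Fintype V] [DecidableEq V] in
/-- Membership in the tied set of the star. -/
lemma mem_tied_star (hd : Deg3 ends v u₁ u₂ u₃ e₁ e₂ e₃) (ω : Config E) :
    ω ∈ tied {e₁, e₂, e₃} ↔ (ω e₁ = ω e₂ ∧ ω e₂ = ω e₃) := by
  unfold tied
  simp only [Set.mem_setOf_eq, Finset.mem_insert, Finset.mem_singleton]
  constructor
  · intro h
    exact ⟨h e₁ (Or.inl rfl) e₂ (Or.inr (Or.inl rfl)), h e₂ (Or.inr (Or.inl rfl)) e₃ (Or.inr (Or.inr rfl))⟩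
  · rintro ⟨h12, h23⟩ e he e' he'
    rcases he with rfl | rfl | rfl <;> rcases he' with rfl | rfl | rfl <;>
      first | rfl | exact h12 | exact h12.symm | exact h23 | exact h23.symm | exact h12.trans h23 |
        exact (h12.trans h23).symm

/-- Monochromatic star: the term is the tied term. -/
lemma term_mono3 (hd : Deg3 ends v u₁ u₂ u₃ e₁ e₂ e₃) (hsv : s ≠ v) {ω : Config E}
    (h12 : ω e₁ = ω e₂) (h23 : ω e₂ = ω e₃) :
    (if ω ∈ twoWorld ends s A X B Y ∧ ¬ (Conn ends ω s v ∧ Conn ends (compl ω) s v) then (1 : ℕ) else 0) = (if ω ∈ twoWorld ends s A X B Y ∧ ω ∈ tied {e₁, e₂, e₃} then (1 : ℕ) else 0) := by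
  have hcore : ¬ (Conn ends ω s v ∧ Conn ends (compl ω) s v) := by
    rintro ⟨hv1, hv2⟩
    cases h : ω e₁ with
    | false => exact not_conn_of_star3_closed ends s hd hsv h (h12 ▸ h) ((h12.trans h23) ▸ h) hv1
    | true =>
      have c1 : compl ω e₁ = false := by simp [compl_apply, h]
      have c2 : compl ω e₂ = false := by simp [compl_apply, ← h12, h]
      have c3 : compl ω e₃ = false := by simp [compl_apply, ← h23, ← h12, h]
      exact not_conn_of_star3_closed ends s hd hsv c1 c2 c3 hv2
  have htied : ω ∈ tied {e₁, e₂, e₃} := (mem_tied_star ends hd ω).2 ⟨h12, h23⟩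
  by_cases h : ω ∈ twoWorld ends s A X B Y
  · rw [if_pos ⟨h, hcore⟩, if_pos ⟨h, htied⟩]
  · rw [if_neg (fun h' => h h'.1), if_neg (fun h' => h h'.1)]

/-- Pattern `e₁, e₂` red, `e₃` blue: the term is the `G⁺` term with the pin `[u₁ ∈ K₁][u₃ ∈ K₂]`. -/
lemma term_TTF (hd : Deg3 ends v u₁ u₂ u₃ e₁ e₂ e₃) (hsv : s ≠ v) (hv : v ∉ A ∪ X ∪ B ∪ Y)
    {ω : Config E} (h1 : ω e₁ = true) (h2 : ω e₂ = true) (h3 : ω e₃ = false) :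
    (if ω ∈ twoWorld ends s A X B Y ∧ ¬ (Conn ends ω s v ∧ Conn ends (compl ω) s v) then (1 : ℕ) else 0) = (if ω ∈ twoWorld (endsP3 ends v u₁ u₂ e₁ e₂ e₃) s A X B Y then (if ω e₁ = true then (if (Conn (endsP3 ends v u₁ u₂ e₁ e₂ e₃) ω s u₁ ∧ Conn (endsP3 ends v u₁ u₂ e₁ e₂ e₃) (compl ω) s u₃) then 0 else 1) else (if (Conn (endsP3 ends v u₁ u₂ e₁ e₂ e₃) ω s u₃ ∧ Conn (endsP3 ends v u₁ u₂ e₁ e₂ e₃) (compl ω) s u₁) then 0 else 1)) else (0 : ℕ)) := by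
  have hw : ∀ w ∈ A ∪ X ∪ B ∪ Y, w ≠ v := fun w hw hwv => hv (hwv ▸ hw)
  obtain ⟨hc1, hv1⟩ := conn_iff_endsP3_merge ends s hd hsv h1 h2 h3
  have c1 : compl ω e₁ = false := by simp [compl_apply, h1]
  have c2 : compl ω e₂ = false := by simp [compl_apply, h2]
  have c3 : compl ω e₃ = true := by simp [compl_apply, h3]
  obtain ⟨hc2, hv2⟩ := conn_iff_endsP3_leaf ends s hd hsv c1 c2 c3
  have htw : ω ∈ twoWorld ends s A X B Y ↔ ω ∈ twoWorld (endsP3 ends v u₁ u₂ e₁ e₂ e₃) s A X B Y :=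
    mem_twoWorld_iff_of_conn_iff ends s A X B Y (fun w hw' => hc1 w (hw w hw'))
      (fun w hw' => hc2 w (hw w hw'))
  by_cases h : ω ∈ twoWorld ends s A X B Y
  · rw [if_pos (htw.1 h), if_pos h1]
    by_cases hp : (Conn (endsP3 ends v u₁ u₂ e₁ e₂ e₃) ω s u₁ ∧ Conn (endsP3 ends v u₁ u₂ e₁ e₂ e₃) (compl ω) s u₃)
    · rw [if_pos hp, if_neg (show ¬ (ω ∈ twoWorld ends s A X B Y ∧ ¬ (Conn ends ω s v ∧ Conn ends (compl ω) s v)) from fun h' => h'.2 ⟨hv1.2 hp.1, hv2.2 hp.2⟩)]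
    · rw [if_neg hp, if_pos (show ω ∈ twoWorld ends s A X B Y ∧ ¬ (Conn ends ω s v ∧ Conn ends (compl ω) s v) from ⟨h, fun hc => hp ⟨hv1.1 hc.1, hv2.1 hc.2⟩⟩)]
  · rw [if_neg (fun h' => h h'.1), if_neg (fun h' => h (htw.2 h'))]

/-- Pattern `e₁, e₂` blue, `e₃` red: the term is the `G⁺` term with the pin `[u₃ ∈ K₁][u₁ ∈ K₂]`. -/
lemma term_FFT (hd : Deg3 ends v u₁ u₂ u₃ e₁ e₂ e₃) (hsv : s ≠ v) (hv : v ∉ A ∪ X ∪ B ∪ Y)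
    {ω : Config E} (h1 : ω e₁ = false) (h2 : ω e₂ = false) (h3 : ω e₃ = true) :
    (if ω ∈ twoWorld ends s A X B Y ∧ ¬ (Conn ends ω s v ∧ Conn ends (compl ω) s v) then (1 : ℕ) else 0) = (if ω ∈ twoWorld (endsP3 ends v u₁ u₂ e₁ e₂ e₃) s A X B Y then (if ω e₁ = true then (if (Conn (endsP3 ends v u₁ u₂ e₁ e₂ e₃) ω s u₁ ∧ Conn (endsP3 ends v u₁ u₂ e₁ e₂ e₃) (compl ω) s u₃) then 0 else 1) else (if (Conn (endsP3 ends v u₁ u₂ e₁ e₂ e₃) ω s u₃ ∧ Conn (endsP3 ends v u₁ u₂ e₁ e₂ e₃) (compl ω) s u₁) then 0 else 1)) else (0 : ℕ)) := by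
  have hw : ∀ w ∈ A ∪ X ∪ B ∪ Y, w ≠ v := fun w hw hwv => hv (hwv ▸ hw)
  obtain ⟨hc1, hv1⟩ := conn_iff_endsP3_leaf ends s hd hsv h1 h2 h3
  have c1 : compl ω e₁ = true := by simp [compl_apply, h1]
  have c2 : compl ω e₂ = true := by simp [compl_apply, h2]
  have c3 : compl ω e₃ = false := by simp [compl_apply, h3]
  obtain ⟨hc2, hv2⟩ := conn_iff_endsP3_merge ends s hd hsv c1 c2 c3
  have htw : ω ∈ twoWorld ends s A X B Y ↔ ω ∈ twoWorld (endsP3 ends v u₁ u₂ e₁ e₂ e₃) s A X B Y :=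
    mem_twoWorld_iff_of_conn_iff ends s A X B Y (fun w hw' => hc1 w (hw w hw'))
      (fun w hw' => hc2 w (hw w hw'))
  by_cases h : ω ∈ twoWorld ends s A X B Y
  · rw [if_pos (htw.1 h), if_neg (show ¬ (ω e₁ = true) from by rw [h1]; exact Bool.false_ne_true)]
    by_cases hp : (Conn (endsP3 ends v u₁ u₂ e₁ e₂ e₃) ω s u₃ ∧ Conn (endsP3 ends v u₁ u₂ e₁ e₂ e₃) (compl ω) s u₁)
    · rw [if_pos hp, if_neg (show ¬ (ω ∈ twoWorld ends s A X B Y ∧ ¬ (Conn ends ω s v ∧ Conn ends (compl ω) s v)) from fun h' => h'.2 ⟨hv1.2 hp.1, hv2.2 hp.2⟩)]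
    · rw [if_neg hp, if_pos (show ω ∈ twoWorld ends s A X B Y ∧ ¬ (Conn ends ω s v ∧ Conn ends (compl ω) s v) from ⟨h, fun hc => hp ⟨hv1.1 hc.1, hv2.1 hc.2⟩⟩)]
  · rw [if_neg (fun h' => h h'.1), if_neg (fun h' => h (htw.2 h'))]

/-- The class function is blind to the colour of `e₂` and of `e₃` (loops of `G⁺`). -/
lemma g3_flip (hd : Deg3 ends v u₁ u₂ u₃ e₁ e₂ e₃) {e : E} (he : e = e₂ ∨ e = e₃) (ω : Config E) :
    (if (flipE e ω) ∈ twoWorld (endsP3 ends v u₁ u₂ e₁ e₂ e₃) s A X B Y then (if (flipE e ω) e₁ = true then (if (Conn (endsP3 ends v u₁ u₂ e₁ e₂ e₃) (flipE e ω) s u₁ ∧ Conn (endsP3 ends v u₁ u₂ e₁ e₂ e₃) (compl (flipE e ω)) s u₃) then 0 else 1) else (if (Conn (endsP3 ends v u₁ u₂ e₁ e₂ e₃) (flipE e ω) s u₃ ∧ Conn (endsP3 ends v u₁ u₂ e₁ e₂ e₃) (compl (flipE e ω)) s u₁) then 0 else 1)) else (0 : ℕ)) = (if ω ∈ twoWorld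 (endsP3 ends v u₁ u₂ e₁ e₂ e₃) s A X B Y then (if ω e₁ = true then (if (Conn (endsP3 ends v u₁ u₂ e₁ e₂ e₃) ω s u₁ ∧ Conn (endsP3 ends v u₁ u₂ e₁ e₂ e₃) (compl ω) s u₃) then 0 else 1) else (if (Conn (endsP3 ends v u₁ u₂ e₁ e₂ e₃) ω s u₃ ∧ Conn (endsP3 ends v u₁ u₂ e₁ e₂ e₃) (compl ω) s u₁) then 0 else 1)) else (0 : ℕ)) := by
  have hloop : (endsP3 ends v u₁ u₂ e₁ e₂ e₃ e).IsDiag := by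
    rcases he with rfl | rfl
    · rw [endsP3_e₂ ends hd.ne23]; exact Sym2.mk_isDiag_iff.2 rfl
    · rw [endsP3_e₃]; exact Sym2.mk_isDiag_iff.2 rfl
  have hne : e₁ ≠ e := by
    rcases he with rfl | rfl
    · exact hd.ne12
    · exact hd.ne13
  have h1 : flipE e ω e₁ = ω e₁ := flipE_apply_of_ne hne ω
  unfold flipE at h1 ⊢
  simp only [mem_twoWorld_update_of_loop s hloop, compl_update_flip, conn_update_of_loop hloop, h1]

omit [Fintype E] [DecidableEq E] [Fintype V] [DecidableEq V] in
/-- The selector of the three-edge colour pattern: monochromatic / `e₃` alone / `e₂` alone / `e₁` alone. -/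
def sel3 (b₁ b₂ b₃ : Bool) (m g₃ g₂ g₁ : ℕ) : ℕ :=
  if b₁ = b₂ then (if b₂ = b₃ then m else g₃) else (if b₁ = b₃ then g₂ else g₁)

omit [Fintype V] [DecidableEq V] in
/-- Summing the selector is summing the four colour classes. -/
lemma sum_sel3 (e₁ e₂ e₃ : E) (m g₃ g₂ g₁ : Config E → ℕ) :
    ∑ ω : Config E, sel3 (ω e₁) (ω e₂) (ω e₃) (m ω) (g₃ ω) (g₂ ω) (g₁ ω) =
      ∑ ω : Config E, (if ω e₁ = ω e₂ ∧ ω e₂ = ω e₃ then m ω else 0) +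
        (∑ ω : Config E, (if ω e₁ = ω e₂ ∧ ω e₂ ≠ ω e₃ then g₃ ω else 0) +
          (∑ ω : Config E, (if ω e₁ ≠ ω e₂ ∧ ω e₁ = ω e₃ then g₂ ω else 0) +
            ∑ ω : Config E, (if ω e₁ ≠ ω e₂ ∧ ω e₁ ≠ ω e₃ then g₁ ω else 0))) := by
  rw [← Finset.sum_add_distrib, ← Finset.sum_add_distrib, ← Finset.sum_add_distrib]
  refine Finset.sum_congr rfl fun ω _ => ?_
  cases ω e₁ <;> cases ω e₂ <;> cases ω e₃ <;> simp [sel3]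

/-- The pointwise split by the colour pattern of the star. -/
lemma term_split3 (hd : Deg3 ends v u₁ u₂ u₃ e₁ e₂ e₃) (hsv : s ≠ v) (hv : v ∉ A ∪ X ∪ B ∪ Y)
    (ω : Config E) :
    (if ω ∈ twoWorld ends s A X B Y ∧ ¬ (Conn ends ω s v ∧ Conn ends (compl ω) s v) then (1 : ℕ) else 0) = sel3 (ω e₁) (ω e₂) (ω e₃) (if ω ∈ twoWorld ends s A X B Y ∧ ω ∈ tied {e₁, e₂, e₃} then (1 : ℕ) else 0) (if ω ∈ twoWorld (endsP3 ends v u₁ u₂ e₁ e₂ e₃) s A X B Y then (if ω e₁ = true then (if (Conn (endsP3 ends v u₁ u₂ e₁ e₂ e₃) ω s u₁ ∧ Conn (endsP3 ends v u₁ u₂ e₁ e₂ e₃) (compl ω) s u₃) then 0 else 1) else (if (Conn (endsP3 ends v u₁ u₂ e₁ e₂ e₃) ω s u₃ ∧ Conn (endsP3 ends v u₁ u₂ e₁ e₂ e₃) (compl ω) s u₁) then 0 else 1)) else (0 : ℕ)) (if ω ∈ twoWorld (endsP3 ends v u₃ u₁ e₃ e₁ e₂) s A X B Y then (if ω e₃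 = true then (if (Conn (endsP3 ends v u₃ u₁ e₃ e₁ e₂) ω s u₃ ∧ Conn (endsP3 ends v u₃ u₁ e₃ e₁ e₂) (compl ω) s u₂) then 0 else 1) else (if (Conn (endsP3 ends v u₃ u₁ e₃ e₁ e₂) ω s u₂ ∧ Conn (endsP3 ends v u₃ u₁ e₃ e₁ e₂) (compl ω) s u₃) then 0 else 1)) else (0 : ℕ)) (if ω ∈ twoWorld (endsP3 ends v u₂ u₃ e₂ e₃ e₁) s A X B Y then (if ω e₂ = true then (if (Conn (endsP3 ends v u₂ u₃ e₂ e₃ e₁) ω s u₂ ∧ Conn (endsP3 ends v u₂ u₃ e₂ e₃ e₁) (compl ω) s u₁) then 0 else 1) else (if (Conn (endsP3 ends v u₂ u₃ e₂ e₃ e₁) ω s u₁ ∧ Conn (endsP3 ends v u₂ u₃ e₂ e₃ e₁) (compl ω) s u₂) then 0 else 1)) else (0 : ℕ)) := by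
  by_cases h1 : ω e₁ = true <;> by_cases h2 : ω e₂ = true <;> by_cases h3 : ω e₃ = true
  · have k1 : ω e₁ = true := h1
    have k2 : ω e₂ = true := h2
    have k3 : ω e₃ = true := h3
    rw [show sel3 (ω e₁) (ω e₂) (ω e₃) (if ω ∈ twoWorld ends s A X B Y ∧ ω ∈ tied {e₁, e₂, e₃} then (1 : ℕ) else 0) (if ω ∈ twoWorld (endsP3 ends v u₁ u₂ e₁ e₂ e₃) s A X B Y then (if ω e₁ = true then (if (Conn (endsP3 ends v u₁ u₂ e₁ e₂ e₃) ω s u₁ ∧ Conn (endsP3 ends v u₁ u₂ e₁ e₂ e₃) (compl ω) s u₃) then 0 else 1) else (if (Conn (endsP3 ends v u₁ u₂ e₁ e₂ e₃) ω s u₃ ∧ Conn (endsP3 ends v u₁ u₂ e₁ e₂ e₃) (compl ω) s u₁) then 0 else 1)) else (0 : ℕ)) (if ω ∈ twoWorld (endsP3 ends v u₃ u₁ e₃ e₁ e₂) s A X B Y then (if ω e₃ = true then (if (Conn (endsP3 ends v u₃ u₁ e₃ e₁ e₂) ω s u₃ ∧ Conn (endsP3 ends v u₃ u₁ e₃ e₁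 e₂) (compl ω) s u₂) then 0 else 1) else (if (Conn (endsP3 ends v u₃ u₁ e₃ e₁ e₂) ω s u₂ ∧ Conn (endsP3 ends v u₃ u₁ e₃ e₁ e₂) (compl ω) s u₃) then 0 else 1)) else (0 : ℕ)) (if ω ∈ twoWorld (endsP3 ends v u₂ u₃ e₂ e₃ e₁) s A X B Y then (if ω e₂ = true then (if (Conn (endsP3 ends v u₂ u₃ e₂ e₃ e₁) ω s u₂ ∧ Conn (endsP3 ends v u₂ u₃ e₂ e₃ e₁) (compl ω) s u₁) then 0 else 1) else (if (Conn (endsP3 ends v u₂ u₃ e₂ e₃ e₁) ω s u₁ ∧ Conn (endsP3 ends v u₂ u₃ e₂ e₃ e₁) (compl ω) s u₂) then 0 else 1)) else (0 : ℕ)) = (if ω ∈ twoWorld ends s A X B Y ∧ ω ∈ tied {e₁, e₂, e₃} then (1 : ℕ) else 0) from by rw [k1, k2, k3]; rfl]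
    exact term_mono3 ends s A X B Y hd hsv (k1.trans k2.symm) (k2.trans k3.symm)
  · have k1 : ω e₁ = true := h1
    have k2 : ω e₂ = true := h2
    have k3 : ω e₃ = false := Bool.eq_false_iff.2 h3
    rw [show sel3 (ω e₁) (ω e₂) (ω e₃) (if ω ∈ twoWorld ends s A X B Y ∧ ω ∈ tied {e₁, e₂, e₃} then (1 : ℕ) else 0) (if ω ∈ twoWorld (endsP3 ends v u₁ u₂ e₁ e₂ e₃) s A X B Y then (if ω e₁ = true then (if (Conn (endsP3 ends v u₁ u₂ e₁ e₂ e₃) ω s u₁ ∧ Conn (endsP3 ends v u₁ u₂ e₁ e₂ e₃) (compl ω) s u₃) then 0 else 1) else (if (Conn (endsP3 ends v u₁ u₂ e₁ e₂ e₃) ω s u₃ ∧ Conn (endsP3 ends v u₁ u₂ e₁ e₂ e₃) (compl ω) s u₁) then 0 else 1)) else (0 : ℕ)) (if ω ∈ twoWorld (endsP3 ends v u₃ u₁ e₃ e₁ e₂) s A X B Y then (if ω e₃ = true then (if (Conn (endsP3 ends v u₃ u₁ e₃ e₁ e₂) ω s u₃ ∧ Conn (endsP3 ends v u₃ u₁ e₃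 e₁ e₂) (compl ω) s u₂) then 0 else 1) else (if (Conn (endsP3 ends v u₃ u₁ e₃ e₁ e₂) ω s u₂ ∧ Conn (endsP3 ends v u₃ u₁ e₃ e₁ e₂) (compl ω) s u₃) then 0 else 1)) else (0 : ℕ)) (if ω ∈ twoWorld (endsP3 ends v u₂ u₃ e₂ e₃ e₁) s A X B Y then (if ω e₂ = true then (if (Conn (endsP3 ends v u₂ u₃ e₂ e₃ e₁) ω s u₂ ∧ Conn (endsP3 ends v u₂ u₃ e₂ e₃ e₁) (compl ω) s u₁) then 0 else 1) else (if (Conn (endsP3 ends v u₂ u₃ e₂ e₃ e₁) ω s u₁ ∧ Conn (endsP3 ends v u₂ u₃ e₂ e₃ e₁) (compl ω) s u₂) then 0 else 1)) else (0 : ℕ)) = (if ω ∈ twoWorld (endsP3 ends v u₁ u₂ e₁ e₂ e₃) s A X B Y then (if ω e₁ = true then (if (Conn (endsP3 ends v u₁ u₂ e₁ e₂ e₃) ω s u₁ ∧ Conn (endsP3 ends v u₁ u₂ e₁ e₂ e₃) (compl ω) s u₃) then 0 else 1) else (if (Conn (endsP3 ends v u₁ u₂ e₁ e₂ e₃) ω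 s u₃ ∧ Conn (endsP3 ends v u₁ u₂ e₁ e₂ e₃) (compl ω) s u₁) then 0 else 1)) else (0 : ℕ)) from by rw [k1, k2, k3]; rfl]
    exact term_TTF ends s A X B Y hd hsv hv k1 k2 k3
  · have k1 : ω e₁ = true := h1
    have k2 : ω e₂ = false := Bool.eq_false_iff.2 h2
    have k3 : ω e₃ = true := h3
    rw [show sel3 (ω e₁) (ω e₂) (ω e₃) (if ω ∈ twoWorld ends s A X B Y ∧ ω ∈ tied {e₁, e₂, e₃} then (1 : ℕ) else 0) (if ω ∈ twoWorld (endsP3 ends v u₁ u₂ e₁ e₂ e₃) s A X B Y then (if ω e₁ = true then (if (Conn (endsP3 ends v u₁ u₂ e₁ e₂ e₃) ω s u₁ ∧ Conn (endsP3 ends v u₁ u₂ e₁ e₂ e₃) (compl ω) s u₃) then 0 else 1) else (if (Conn (endsP3 ends v u₁ u₂ e₁ e₂ e₃) ω s u₃ ∧ Conn (endsP3 ends v u₁ u₂ e₁ e₂ e₃) (compl ω) s u₁) then 0 else 1)) else (0 : ℕ)) (if ω ∈ twoWorld (endsP3 ends v u₃ u₁ e₃ e₁ e₂) s A X B Y then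 (if ω e₃ = true then (if (Conn (endsP3 ends v u₃ u₁ e₃ e₁ e₂) ω s u₃ ∧ Conn (endsP3 ends v u₃ u₁ e₃ e₁ e₂) (compl ω) s u₂) then 0 else 1) else (if (Conn (endsP3 ends v u₃ u₁ e₃ e₁ e₂) ω s u₂ ∧ Conn (endsP3 ends v u₃ u₁ e₃ e₁ e₂) (compl ω) s u₃) then 0 else 1)) else (0 : ℕ)) (if ω ∈ twoWorld (endsP3 ends v u₂ u₃ e₂ e₃ e₁) s A X B Y then (if ω e₂ = true then (if (Conn (endsP3 ends v u₂ u₃ e₂ e₃ e₁) ω s u₂ ∧ Conn (endsP3 ends v u₂ u₃ e₂ e₃ e₁) (compl ω) s u₁) then 0 else 1) else (if (Conn (endsP3 ends v u₂ u₃ e₂ e₃ e₁) ω s u₁ ∧ Conn (endsP3 ends v u₂ u₃ e₂ e₃ e₁) (compl ω) s u₂) then 0 else 1)) else (0 : ℕ)) = (if ω ∈ twoWorld (endsP3 ends v u₃ u₁ e₃ e₁ e₂) s A X B Y then (if ω e₃ = true then (if (Conn (endsP3 ends v u₃ u₁ e₃ e₁ e₂) ω s u₃ ∧ Conn (endsP3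 ends v u₃ u₁ e₃ e₁ e₂) (compl ω) s u₂) then 0 else 1) else (if (Conn (endsP3 ends v u₃ u₁ e₃ e₁ e₂) ω s u₂ ∧ Conn (endsP3 ends v u₃ u₁ e₃ e₁ e₂) (compl ω) s u₃) then 0 else 1)) else (0 : ℕ)) from by rw [k1, k2, k3]; rfl]
    exact term_TTF ends s A X B Y hd.rot.rot hsv hv k3 k1 k2
  · have k1 : ω e₁ = true := h1
    have k2 : ω e₂ = false := Bool.eq_false_iff.2 h2
    have k3 : ω e₃ = false := Bool.eq_false_iff.2 h3
    rw [show sel3 (ω e₁) (ω e₂) (ω e₃) (if ω ∈ twoWorld ends s A X B Y ∧ ω ∈ tied {e₁, e₂, e₃} then (1 : ℕ) else 0) (if ω ∈ twoWorld (endsP3 ends v u₁ u₂ e₁ e₂ e₃) s A X B Y then (if ω e₁ = true then (if (Conn (endsP3 ends v u₁ u₂ e₁ e₂ e₃) ω s u₁ ∧ Conn (endsP3 ends v u₁ u₂ e₁ e₂ e₃) (compl ω) s u₃) then 0 else 1) else (if (Conn (endsP3 ends v u₁ u₂ e₁ e₂ e₃) ω s u₃ ∧ Conn (endsP3 ends v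 u₁ u₂ e₁ e₂ e₃) (compl ω) s u₁) then 0 else 1)) else (0 : ℕ)) (if ω ∈ twoWorld (endsP3 ends v u₃ u₁ e₃ e₁ e₂) s A X B Y then (if ω e₃ = true then (if (Conn (endsP3 ends v u₃ u₁ e₃ e₁ e₂) ω s u₃ ∧ Conn (endsP3 ends v u₃ u₁ e₃ e₁ e₂) (compl ω) s u₂) then 0 else 1) else (if (Conn (endsP3 ends v u₃ u₁ e₃ e₁ e₂) ω s u₂ ∧ Conn (endsP3 ends v u₃ u₁ e₃ e₁ e₂) (compl ω) s u₃) then 0 else 1)) else (0 : ℕ)) (if ω ∈ twoWorld (endsP3 ends v u₂ u₃ e₂ e₃ e₁) s A X B Y then (if ω e₂ = true then (if (Conn (endsP3 ends v u₂ u₃ e₂ e₃ e₁) ω s u₂ ∧ Conn (endsP3 ends v u₂ u₃ e₂ e₃ e₁) (compl ω) s u₁) then 0 else 1) else (if (Conn (endsP3 ends v u₂ u₃ e₂ e₃ e₁) ω s u₁ ∧ Conn (endsP3 ends v u₂ u₃ e₂ e₃ e₁) (compl ω) s u₂) then 0 else 1)) else (0 : ℕ)) = (if ω ∈ twoWorld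 (endsP3 ends v u₂ u₃ e₂ e₃ e₁) s A X B Y then (if ω e₂ = true then (if (Conn (endsP3 ends v u₂ u₃ e₂ e₃ e₁) ω s u₂ ∧ Conn (endsP3 ends v u₂ u₃ e₂ e₃ e₁) (compl ω) s u₁) then 0 else 1) else (if (Conn (endsP3 ends v u₂ u₃ e₂ e₃ e₁) ω s u₁ ∧ Conn (endsP3 ends v u₂ u₃ e₂ e₃ e₁) (compl ω) s u₂) then 0 else 1)) else (0 : ℕ)) from by rw [k1, k2, k3]; rfl]
    exact term_FFT ends s A X B Y hd.rot hsv hv k2 k3 k1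
  · have k1 : ω e₁ = false := Bool.eq_false_iff.2 h1
    have k2 : ω e₂ = true := h2
    have k3 : ω e₃ = true := h3
    rw [show sel3 (ω e₁) (ω e₂) (ω e₃) (if ω ∈ twoWorld ends s A X B Y ∧ ω ∈ tied {e₁, e₂, e₃} then (1 : ℕ) else 0) (if ω ∈ twoWorld (endsP3 ends v u₁ u₂ e₁ e₂ e₃) s A X B Y then (if ω e₁ = true then (if (Conn (endsP3 ends v u₁ u₂ e₁ e₂ e₃) ω s u₁ ∧ Conn (endsP3 ends v u₁ u₂ e₁ e₂ e₃) (compl ω) s u₃) then 0 else 1) else (if (Conn (endsP3 ends v u₁ u₂ e₁ e₂ e₃) ω s u₃ ∧ Conn (endsP3 ends v u₁ u₂ e₁ e₂ e₃) (compl ω) s u₁) then 0 else 1)) else (0 : ℕ)) (if ω ∈ twoWorld (endsP3 ends v u₃ u₁ e₃ e₁ e₂) s A X B Y then (if ω e₃ = true then (if (Conn (endsP3 ends v u₃ u₁ e₃ e₁ e₂) ω s u₃ ∧ Conn (endsP3 ends v u₃ u₁ e₃ e₁ e₂) (compl ω) s u₂) then 0 else 1) else (if (Conn (endsP3 ends v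 u₃ u₁ e₃ e₁ e₂) ω s u₂ ∧ Conn (endsP3 ends v u₃ u₁ e₃ e₁ e₂) (compl ω) s u₃) then 0 else 1)) else (0 : ℕ)) (if ω ∈ twoWorld (endsP3 ends v u₂ u₃ e₂ e₃ e₁) s A X B Y then (if ω e₂ = true then (if (Conn (endsP3 ends v u₂ u₃ e₂ e₃ e₁) ω s u₂ ∧ Conn (endsP3 ends v u₂ u₃ e₂ e₃ e₁) (compl ω) s u₁) then 0 else 1) else (if (Conn (endsP3 ends v u₂ u₃ e₂ e₃ e₁) ω s u₁ ∧ Conn (endsP3 ends v u₂ u₃ e₂ e₃ e₁) (compl ω) s u₂) then 0 else 1)) else (0 : ℕ)) = (if ω ∈ twoWorld (endsP3 ends v u₂ u₃ e₂ e₃ e₁) s A X B Y then (if ω e₂ = true then (if (Conn (endsP3 ends v u₂ u₃ e₂ e₃ e₁) ω s u₂ ∧ Conn (endsP3 ends v u₂ u₃ e₂ e₃ e₁) (compl ω) s u₁) then 0 else 1) else (if (Conn (endsP3 ends v u₂ u₃ e₂ e₃ e₁) ω s u₁ ∧ Conn (endsP3 ends v u₂ u₃ e₂ e₃ e₁) (compl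 ω) s u₂) then 0 else 1)) else (0 : ℕ)) from by rw [k1, k2, k3]; rfl]
    exact term_TTF ends s A X B Y hd.rot hsv hv k2 k3 k1
  · have k1 : ω e₁ = false := Bool.eq_false_iff.2 h1
    have k2 : ω e₂ = true := h2
    have k3 : ω e₃ = false := Bool.eq_false_iff.2 h3
    rw [show sel3 (ω e₁) (ω e₂) (ω e₃) (if ω ∈ twoWorld ends s A X B Y ∧ ω ∈ tied {e₁, e₂, e₃} then (1 : ℕ) else 0) (if ω ∈ twoWorld (endsP3 ends v u₁ u₂ e₁ e₂ e₃) s A X B Y then (if ω e₁ = true then (if (Conn (endsP3 ends v u₁ u₂ e₁ e₂ e₃) ω s u₁ ∧ Conn (endsP3 ends v u₁ u₂ e₁ e₂ e₃) (compl ω) s u₃) then 0 else 1) else (if (Conn (endsP3 ends v u₁ u₂ e₁ e₂ e₃) ω s u₃ ∧ Conn (endsP3 ends v u₁ u₂ e₁ e₂ e₃) (compl ω) s u₁) then 0 else 1)) else (0 : ℕ)) (if ω ∈ twoWorld (endsP3 ends v u₃ u₁ e₃ e₁ e₂) s A X B Y then (if ω e₃ = true then (if (Conn (endsP3 ends v u₃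 u₁ e₃ e₁ e₂) ω s u₃ ∧ Conn (endsP3 ends v u₃ u₁ e₃ e₁ e₂) (compl ω) s u₂) then 0 else 1) else (if (Conn (endsP3 ends v u₃ u₁ e₃ e₁ e₂) ω s u₂ ∧ Conn (endsP3 ends v u₃ u₁ e₃ e₁ e₂) (compl ω) s u₃) then 0 else 1)) else (0 : ℕ)) (if ω ∈ twoWorld (endsP3 ends v u₂ u₃ e₂ e₃ e₁) s A X B Y then (if ω e₂ = true then (if (Conn (endsP3 ends v u₂ u₃ e₂ e₃ e₁) ω s u₂ ∧ Conn (endsP3 ends v u₂ u₃ e₂ e₃ e₁) (compl ω) s u₁) then 0 else 1) else (if (Conn (endsP3 ends v u₂ u₃ e₂ e₃ e₁) ω s u₁ ∧ Conn (endsP3 ends v u₂ u₃ e₂ e₃ e₁) (compl ω) s u₂) then 0 else 1)) else (0 : ℕ)) = (if ω ∈ twoWorld (endsP3 ends v u₃ u₁ e₃ e₁ e₂) s A X B Y then (if ω e₃ = true then (if (Conn (endsP3 ends v u₃ u₁ e₃ e₁ e₂) ω s u₃ ∧ Conn (endsP3 ends v u₃ u₁ e₃ e₁ e₂) (compl ω)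 s u₂) then 0 else 1) else (if (Conn (endsP3 ends v u₃ u₁ e₃ e₁ e₂) ω s u₂ ∧ Conn (endsP3 ends v u₃ u₁ e₃ e₁ e₂) (compl ω) s u₃) then 0 else 1)) else (0 : ℕ)) from by rw [k1, k2, k3]; rfl]
    exact term_FFT ends s A X B Y hd.rot.rot hsv hv k3 k1 k2
  · have k1 : ω e₁ = false := Bool.eq_false_iff.2 h1
    have k2 : ω e₂ = false := Bool.eq_false_iff.2 h2
    have k3 : ω e₃ = true := h3
    rw [show sel3 (ω e₁) (ω e₂) (ω e₃) (if ω ∈ twoWorld ends s A X B Y ∧ ω ∈ tied {e₁, e₂, e₃} then (1 : ℕ) else 0) (if ω ∈ twoWorld (endsP3 ends v u₁ u₂ e₁ e₂ e₃) s A X B Y then (if ω e₁ = true then (if (Conn (endsP3 ends v u₁ u₂ e₁ e₂ e₃) ω s u₁ ∧ Conn (endsP3 ends v u₁ u₂ e₁ e₂ e₃) (compl ω) s u₃) then 0 else 1) else (if (Conn (endsP3 ends v u₁ u₂ e₁ e₂ e₃) ω s u₃ ∧ Conn (endsP3 ends v u₁ u₂ e₁ e₂ e₃) (compl ω) s u₁)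 then 0 else 1)) else (0 : ℕ)) (if ω ∈ twoWorld (endsP3 ends v u₃ u₁ e₃ e₁ e₂) s A X B Y then (if ω e₃ = true then (if (Conn (endsP3 ends v u₃ u₁ e₃ e₁ e₂) ω s u₃ ∧ Conn (endsP3 ends v u₃ u₁ e₃ e₁ e₂) (compl ω) s u₂) then 0 else 1) else (if (Conn (endsP3 ends v u₃ u₁ e₃ e₁ e₂) ω s u₂ ∧ Conn (endsP3 ends v u₃ u₁ e₃ e₁ e₂) (compl ω) s u₃) then 0 else 1)) else (0 : ℕ)) (if ω ∈ twoWorld (endsP3 ends v u₂ u₃ e₂ e₃ e₁) s A X B Y then (if ω e₂ = true then (if (Conn (endsP3 ends v u₂ u₃ e₂ e₃ e₁) ω s u₂ ∧ Conn (endsP3 ends v u₂ u₃ e₂ e₃ e₁) (compl ω) s u₁) then 0 else 1) else (if (Conn (endsP3 ends v u₂ u₃ e₂ e₃ e₁) ω s u₁ ∧ Conn (endsP3 ends v u₂ u₃ e₂ e₃ e₁) (compl ω) s u₂) then 0 else 1)) else (0 : ℕ)) = (if ω ∈ twoWorld (endsP3 ends v u₁ u₂ e₁ e₂ e₃) s A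 X B Y then (if ω e₁ = true then (if (Conn (endsP3 ends v u₁ u₂ e₁ e₂ e₃) ω s u₁ ∧ Conn (endsP3 ends v u₁ u₂ e₁ e₂ e₃) (compl ω) s u₃) then 0 else 1) else (if (Conn (endsP3 ends v u₁ u₂ e₁ e₂ e₃) ω s u₃ ∧ Conn (endsP3 ends v u₁ u₂ e₁ e₂ e₃) (compl ω) s u₁) then 0 else 1)) else (0 : ℕ)) from by rw [k1, k2, k3]; rfl]
    exact term_FFT ends s A X B Y hd hsv hv k1 k2 k3
  · have k1 : ω e₁ = false := Bool.eq_false_iff.2 h1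
    have k2 : ω e₂ = false := Bool.eq_false_iff.2 h2
    have k3 : ω e₃ = false := Bool.eq_false_iff.2 h3
    rw [show sel3 (ω e₁) (ω e₂) (ω e₃) (if ω ∈ twoWorld ends s A X B Y ∧ ω ∈ tied {e₁, e₂, e₃} then (1 : ℕ) else 0) (if ω ∈ twoWorld (endsP3 ends v u₁ u₂ e₁ e₂ e₃) s A X B Y then (if ω e₁ = true then (if (Conn (endsP3 ends v u₁ u₂ e₁ e₂ e₃) ω s u₁ ∧ Conn (endsP3 ends v u₁ u₂ e₁ e₂ e₃) (compl ω) s u₃) then 0 else 1) else (if (Conn (endsP3 ends v u₁ u₂ e₁ e₂ e₃) ω s u₃ ∧ Conn (endsP3 ends v u₁ u₂ e₁ e₂ e₃) (compl ω) s u₁) then 0 else 1)) else (0 : ℕ)) (if ω ∈ twoWorld (endsP3 ends v u₃ u₁ e₃ e₁ e₂) s A X B Y then (if ω e₃ = true then (if (Conn (endsP3 ends v u₃ u₁ e₃ e₁ e₂) ω s u₃ ∧ Conn (endsP3 ends v u₃ u₁ e₃ e₁ e₂) (compl ω) s u₂) then 0 else 1) else (if (Conn (endsP3 ends v u₃ u₁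 e₃ e₁ e₂) ω s u₂ ∧ Conn (endsP3 ends v u₃ u₁ e₃ e₁ e₂) (compl ω) s u₃) then 0 else 1)) else (0 : ℕ)) (if ω ∈ twoWorld (endsP3 ends v u₂ u₃ e₂ e₃ e₁) s A X B Y then (if ω e₂ = true then (if (Conn (endsP3 ends v u₂ u₃ e₂ e₃ e₁) ω s u₂ ∧ Conn (endsP3 ends v u₂ u₃ e₂ e₃ e₁) (compl ω) s u₁) then 0 else 1) else (if (Conn (endsP3 ends v u₂ u₃ e₂ e₃ e₁) ω s u₁ ∧ Conn (endsP3 ends v u₂ u₃ e₂ e₃ e₁) (compl ω) s u₂) then 0 else 1)) else (0 : ℕ)) = (if ω ∈ twoWorld ends s A X B Y ∧ ω ∈ tied {e₁, e₂, e₃} then (1 : ℕ) else 0) from by rw [k1, k2, k3]; rfl]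
    exact term_mono3 ends s A X B Y hd hsv (k1.trans k2.symm) (k2.trans k3.symm)

omit [Fintype V] [DecidableEq V] in
/-- The two patterns of a class carry a quarter of the class function each (the function is blind to the two
looped edges). -/
lemma four_mul_sum_class (ea eb ec : E) (hab : ea ≠ eb) (hac : ea ≠ ec) (hbc : eb ≠ ec)
    (g : Config E → ℕ) (hgb : ∀ ω, g (flipE eb ω) = g ω) (hgc : ∀ ω, g (flipE ec ω) = g ω) :
    4 * ∑ ω : Config E, (if ω ea = ω eb ∧ ω eb ≠ ω ec then g ω else 0) = ∑ ω : Config E, g ω := by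
  have hsplit : ∑ ω : Config E, (if ω ea = ω eb ∧ ω eb ≠ ω ec then g ω else 0) =
      ∑ ω : Config E, (if ω eb = true ∧ ω ec = false then (if ω ea = true then g ω else 0) else 0) +
        ∑ ω : Config E, (if ω eb = false ∧ ω ec = true then (if ω ea = false then g ω else 0) else 0) := by
    rw [← Finset.sum_add_distrib]
    refine Finset.sum_congr rfl fun ω _ => ?_
    cases ω ea <;> cases ω eb <;> cases ω ec <;> simp
  have hT := four_mul_sum_pattern eb ec hbc (fun ω => if ω ea = true then g ω else 0)
    (fun ω => by simp only [flipE_apply_of_ne hab, hgb]) (fun ω => by simp only [flipE_apply_of_ne hac, hgc])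
    true false
  have hF := four_mul_sum_pattern eb ec hbc (fun ω => if ω ea = false then g ω else 0)
    (fun ω => by simp only [flipE_apply_of_ne hab, hgb]) (fun ω => by simp only [flipE_apply_of_ne hac, hgc])
    false true
  have htot : ∑ ω : Config E, g ω =
      ∑ ω : Config E, (if ω ea = true then g ω else 0) + ∑ ω : Config E, (if ω ea = false then g ω else 0) := by
    rw [← Finset.sum_add_distrib]
    refine Finset.sum_congr rfl fun ω _ => ?_
    cases ω ea <;> simp
  rw [hsplit, mul_add, hT, hF, htot]

/-- **The degree-3 expansion**: `4 · coreCount A X B Y {v} = 4 · #(L ∩ tied) + Σ_k gensym3Count(G⁺_k)`. -/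
theorem four_mul_coreCount_deg3 (hd : Deg3 ends v u₁ u₂ u₃ e₁ e₂ e₃) (hsv : s ≠ v) (hv : v ∉ A ∪ X ∪ B ∪ Y) :
    4 * coreCount ends s A X B Y {v} =
      4 * count (twoWorld ends s A X B Y ∩ tied {e₁, e₂, e₃}) +
        (gensym3Count (endsP3 ends v u₁ u₂ e₁ e₂ e₃) s A X B Y e₁ u₁ u₃ +
          (gensym3Count (endsP3 ends v u₃ u₁ e₃ e₁ e₂) s A X B Y e₃ u₃ u₂ +
            gensym3Count (endsP3 ends v u₂ u₃ e₂ e₃ e₁) s A X B Y e₂ u₂ u₁)) := by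
  have hsplit : ∑ ω : Config E, (if ω ∈ twoWorld ends s A X B Y ∧ ¬ (Conn ends ω s v ∧ Conn ends (compl ω) s v) then (1 : ℕ) else 0) =
      ∑ ω : Config E, (if ω e₁ = ω e₂ ∧ ω e₂ = ω e₃ then (if ω ∈ twoWorld ends s A X B Y ∧ ω ∈ tied {e₁, e₂, e₃} then (1 : ℕ) else 0) else 0) +
        (∑ ω : Config E, (if ω e₁ = ω e₂ ∧ ω e₂ ≠ ω e₃ then (if ω ∈ twoWorld (endsP3 ends v u₁ u₂ e₁ e₂ e₃) s A X B Y then (if ω e₁ = true then (if (Conn (endsP3 ends v u₁ u₂ e₁ e₂ e₃) ω s u₁ ∧ Conn (endsP3 ends v u₁ u₂ e₁ e₂ e₃) (compl ω) s u₃) then 0 else 1) else (if (Conn (endsP3 ends v u₁ u₂ e₁ e₂ e₃) ω s u₃ ∧ Conn (endsP3 ends v u₁ u₂ e₁ e₂ e₃) (compl ω) s u₁) then 0 else 1)) else (0 : ℕ)) else 0) +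
          (∑ ω : Config E, (if ω e₁ ≠ ω e₂ ∧ ω e₁ = ω e₃ then (if ω ∈ twoWorld (endsP3 ends v u₃ u₁ e₃ e₁ e₂) s A X B Y then (if ω e₃ = true then (if (Conn (endsP3 ends v u₃ u₁ e₃ e₁ e₂) ω s u₃ ∧ Conn (endsP3 ends v u₃ u₁ e₃ e₁ e₂) (compl ω) s u₂) then 0 else 1) else (if (Conn (endsP3 ends v u₃ u₁ e₃ e₁ e₂) ω s u₂ ∧ Conn (endsP3 ends v u₃ u₁ e₃ e₁ e₂) (compl ω) s u₃) then 0 else 1)) else (0 : ℕ)) else 0) +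
            ∑ ω : Config E, (if ω e₁ ≠ ω e₂ ∧ ω e₁ ≠ ω e₃ then (if ω ∈ twoWorld (endsP3 ends v u₂ u₃ e₂ e₃ e₁) s A X B Y then (if ω e₂ = true then (if (Conn (endsP3 ends v u₂ u₃ e₂ e₃ e₁) ω s u₂ ∧ Conn (endsP3 ends v u₂ u₃ e₂ e₃ e₁) (compl ω) s u₁) then 0 else 1) else (if (Conn (endsP3 ends v u₂ u₃ e₂ e₃ e₁) ω s u₁ ∧ Conn (endsP3 ends v u₂ u₃ e₂ e₃ e₁) (compl ω) s u₂) then 0 else 1)) else (0 : ℕ)) else 0))) := by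
    rw [← sum_sel3]
    exact Finset.sum_congr rfl fun ω _ => term_split3 ends s A X B Y hd hsv hv ω
  -- the monochromatic part is the tied count
  have hM : ∑ ω : Config E, (if ω e₁ = ω e₂ ∧ ω e₂ = ω e₃ then (if ω ∈ twoWorld ends s A X B Y ∧ ω ∈ tied {e₁, e₂, e₃} then (1 : ℕ) else 0) else 0) =
      count (twoWorld ends s A X B Y ∩ tied {e₁, e₂, e₃}) := by
    unfold count
    refine Finset.sum_congr rfl fun ω _ => ?_
    by_cases hm : ω e₁ = ω e₂ ∧ ω e₂ = ω e₃
    · rw [if_pos hm]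
      simp only [Set.mem_inter_iff]
    · rw [if_neg hm]
      have : ω ∉ tied {e₁, e₂, e₃} := fun h => hm ((mem_tied_star ends hd ω).1 h)
      simp only [Set.mem_inter_iff, this, and_false, if_false]
  -- the three classes
  have hG3 := four_mul_sum_class e₁ e₂ e₃ hd.ne12 hd.ne13 hd.ne23 (fun ω => (if ω ∈ twoWorld (endsP3 ends v u₁ u₂ e₁ e₂ e₃) s A X B Y then (if ω e₁ = true then (if (Conn (endsP3 ends v u₁ u₂ e₁ e₂ e₃) ω s u₁ ∧ Conn (endsP3 ends v u₁ u₂ e₁ e₂ e₃) (compl ω) s u₃) then 0 else 1) else (if (Conn (endsP3 ends v u₁ u₂ e₁ e₂ e₃) ω s u₃ ∧ Conn (endsP3 ends v u₁ u₂ e₁ e₂ e₃) (compl ω) s u₁) then 0 else 1)) else (0 : ℕ)))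
    (fun ω => g3_flip ends s A X B Y hd (Or.inl rfl) ω) (fun ω => g3_flip ends s A X B Y hd (Or.inr rfl) ω)
  have hG2 := four_mul_sum_class e₃ e₁ e₂ hd.ne13.symm hd.ne23.symm hd.ne12 (fun ω => (if ω ∈ twoWorld (endsP3 ends v u₃ u₁ e₃ e₁ e₂) s A X B Y then (if ω e₃ = true then (if (Conn (endsP3 ends v u₃ u₁ e₃ e₁ e₂) ω s u₃ ∧ Conn (endsP3 ends v u₃ u₁ e₃ e₁ e₂) (compl ω) s u₂) then 0 else 1) else (if (Conn (endsP3 ends v u₃ u₁ e₃ e₁ e₂) ω s u₂ ∧ Conn (endsP3 ends v u₃ u₁ e₃ e₁ e₂) (compl ω) s u₃) then 0 else 1)) else (0 : ℕ)))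
    (fun ω => g3_flip ends s A X B Y hd.rot.rot (Or.inl rfl) ω)
    (fun ω => g3_flip ends s A X B Y hd.rot.rot (Or.inr rfl) ω)
  have hG1 := four_mul_sum_class e₂ e₃ e₁ hd.ne23 hd.ne12.symm hd.ne13.symm (fun ω => (if ω ∈ twoWorld (endsP3 ends v u₂ u₃ e₂ e₃ e₁) s A X B Y then (if ω e₂ = true then (if (Conn (endsP3 ends v u₂ u₃ e₂ e₃ e₁) ω s u₂ ∧ Conn (endsP3 ends v u₂ u₃ e₂ e₃ e₁) (compl ω) s u₁) then 0 else 1) else (if (Conn (endsP3 ends v u₂ u₃ e₂ e₃ e₁) ω s u₁ ∧ Conn (endsP3 ends v u₂ u₃ e₂ e₃ e₁) (compl ω) s u₂) then 0 else 1)) else (0 : ℕ)))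
    (fun ω => g3_flip ends s A X B Y hd.rot (Or.inl rfl) ω) (fun ω => g3_flip ends s A X B Y hd.rot (Or.inr rfl) ω)
  -- the class conditions in the rotated form
  have c2 : ∑ ω : Config E, (if ω e₁ ≠ ω e₂ ∧ ω e₁ = ω e₃ then (if ω ∈ twoWorld (endsP3 ends v u₃ u₁ e₃ e₁ e₂) s A X B Y then (if ω e₃ = true then (if (Conn (endsP3 ends v u₃ u₁ e₃ e₁ e₂) ω s u₃ ∧ Conn (endsP3 ends v u₃ u₁ e₃ e₁ e₂) (compl ω) s u₂) then 0 else 1) else (if (Conn (endsP3 ends v u₃ u₁ e₃ e₁ e₂) ω s u₂ ∧ Conn (endsP3 ends v u₃ u₁ e₃ e₁ e₂) (compl ω) s u₃) then 0 else 1)) else (0 : ℕ)) else 0) =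
      ∑ ω : Config E, (if ω e₃ = ω e₁ ∧ ω e₁ ≠ ω e₂ then (if ω ∈ twoWorld (endsP3 ends v u₃ u₁ e₃ e₁ e₂) s A X B Y then (if ω e₃ = true then (if (Conn (endsP3 ends v u₃ u₁ e₃ e₁ e₂) ω s u₃ ∧ Conn (endsP3 ends v u₃ u₁ e₃ e₁ e₂) (compl ω) s u₂) then 0 else 1) else (if (Conn (endsP3 ends v u₃ u₁ e₃ e₁ e₂) ω s u₂ ∧ Conn (endsP3 ends v u₃ u₁ e₃ e₁ e₂) (compl ω) s u₃) then 0 else 1)) else (0 : ℕ)) else 0) := by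
    refine Finset.sum_congr rfl fun ω _ => ?_
    by_cases h : ω e₁ ≠ ω e₂ ∧ ω e₁ = ω e₃
    · rw [if_pos h, if_pos (show ω e₃ = ω e₁ ∧ ω e₁ ≠ ω e₂ from ⟨h.2.symm, h.1⟩)]
    · rw [if_neg h, if_neg (show ¬ (ω e₃ = ω e₁ ∧ ω e₁ ≠ ω e₂) from fun h' => h ⟨h'.2, h'.1.symm⟩)]
  have c1 : ∑ ω : Config E, (if ω e₁ ≠ ω e₂ ∧ ω e₁ ≠ ω e₃ then (if ω ∈ twoWorld (endsP3 ends v u₂ u₃ e₂ e₃ e₁) s A X B Y then (if ω e₂ = true then (if (Conn (endsP3 ends v u₂ u₃ e₂ e₃ e₁) ω s u₂ ∧ Conn (endsP3 ends v u₂ u₃ e₂ e₃ e₁) (compl ω) s u₁) then 0 else 1) else (if (Conn (endsP3 ends v u₂ u₃ e₂ e₃ e₁) ω s u₁ ∧ Conn (endsP3 ends v u₂ u₃ e₂ e₃ e₁) (compl ω) s u₂) then 0 else 1)) else (0 : ℕ)) else 0) =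
      ∑ ω : Config E, (if ω e₂ = ω e₃ ∧ ω e₃ ≠ ω e₁ then (if ω ∈ twoWorld (endsP3 ends v u₂ u₃ e₂ e₃ e₁) s A X B Y then (if ω e₂ = true then (if (Conn (endsP3 ends v u₂ u₃ e₂ e₃ e₁) ω s u₂ ∧ Conn (endsP3 ends v u₂ u₃ e₂ e₃ e₁) (compl ω) s u₁) then 0 else 1) else (if (Conn (endsP3 ends v u₂ u₃ e₂ e₃ e₁) ω s u₁ ∧ Conn (endsP3 ends v u₂ u₃ e₂ e₃ e₁) (compl ω) s u₂) then 0 else 1)) else (0 : ℕ)) else 0) := by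
    refine Finset.sum_congr rfl fun ω _ => ?_
    by_cases h : ω e₁ ≠ ω e₂ ∧ ω e₁ ≠ ω e₃
    · have h23 : ω e₂ = ω e₃ := by
        cases k1 : ω e₁ <;> cases k2 : ω e₂ <;> cases k3 : ω e₃ <;> simp_all
      rw [if_pos h, if_pos (show ω e₂ = ω e₃ ∧ ω e₃ ≠ ω e₁ from ⟨h23, fun h' => h.2 h'.symm⟩)]
    · rw [if_neg h, if_neg (show ¬ (ω e₂ = ω e₃ ∧ ω e₃ ≠ ω e₁) from ?_)]
      rintro ⟨h23, h31⟩
      apply h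
      exact ⟨fun h12 => h31 (h23.symm.trans h12.symm), fun h13 => h31 h13.symm⟩
  have hRC : gensym3Count (endsP3 ends v u₁ u₂ e₁ e₂ e₃) s A X B Y e₁ u₁ u₃ = ∑ ω : Config E, (if ω ∈ twoWorld (endsP3 ends v u₁ u₂ e₁ e₂ e₃) s A X B Y then (if ω e₁ = true then (if (Conn (endsP3 ends v u₁ u₂ e₁ e₂ e₃) ω s u₁ ∧ Conn (endsP3 ends v u₁ u₂ e₁ e₂ e₃) (compl ω) s u₃) then 0 else 1) else (if (Conn (endsP3 ends v u₁ u₂ e₁ e₂ e₃) ω s u₃ ∧ Conn (endsP3 ends v u₁ u₂ e₁ e₂ e₃) (compl ω) s u₁) then 0 else 1)) else (0 : ℕ)) := rfl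
  have hRC2 : gensym3Count (endsP3 ends v u₃ u₁ e₃ e₁ e₂) s A X B Y e₃ u₃ u₂ = ∑ ω : Config E, (if ω ∈ twoWorld (endsP3 ends v u₃ u₁ e₃ e₁ e₂) s A X B Y then (if ω e₃ = true then (if (Conn (endsP3 ends v u₃ u₁ e₃ e₁ e₂) ω s u₃ ∧ Conn (endsP3 ends v u₃ u₁ e₃ e₁ e₂) (compl ω) s u₂) then 0 else 1) else (if (Conn (endsP3 ends v u₃ u₁ e₃ e₁ e₂) ω s u₂ ∧ Conn (endsP3 ends v u₃ u₁ e₃ e₁ e₂) (compl ω) s u₃) then 0 else 1)) else (0 : ℕ)) := rfl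
  have hRC1 : gensym3Count (endsP3 ends v u₂ u₃ e₂ e₃ e₁) s A X B Y e₂ u₂ u₁ = ∑ ω : Config E, (if ω ∈ twoWorld (endsP3 ends v u₂ u₃ e₂ e₃ e₁) s A X B Y then (if ω e₂ = true then (if (Conn (endsP3 ends v u₂ u₃ e₂ e₃ e₁) ω s u₂ ∧ Conn (endsP3 ends v u₂ u₃ e₂ e₃ e₁) (compl ω) s u₁) then 0 else 1) else (if (Conn (endsP3 ends v u₂ u₃ e₂ e₃ e₁) ω s u₁ ∧ Conn (endsP3 ends v u₂ u₃ e₂ e₃ e₁) (compl ω) s u₂) then 0 else 1)) else (0 : ℕ)) := rfl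
  rw [coreCount_singleton_eq_sum, hsplit, hM, c2, c1, hRC, hRC2, hRC1]
  beta_reduce at hG3 hG2 hG1
  generalize (∑ ω : Config E, (if ω e₁ = ω e₂ ∧ ω e₂ ≠ ω e₃ then (if ω ∈ twoWorld (endsP3 ends v u₁ u₂ e₁ e₂ e₃) s A X B Y then (if ω e₁ = true then (if (Conn (endsP3 ends v u₁ u₂ e₁ e₂ e₃) ω s u₁ ∧ Conn (endsP3 ends v u₁ u₂ e₁ e₂ e₃) (compl ω) s u₃) then 0 else 1) else (if (Conn (endsP3 ends v u₁ u₂ e₁ e₂ e₃) ω s u₃ ∧ Conn (endsP3 ends v u₁ u₂ e₁ e₂ e₃) (compl ω) s u₁) then 0 else 1)) else (0 : ℕ)) else 0)) = S3 at hG3 ⊢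
  generalize (∑ ω : Config E, (if ω ∈ twoWorld (endsP3 ends v u₁ u₂ e₁ e₂ e₃) s A X B Y then (if ω e₁ = true then (if (Conn (endsP3 ends v u₁ u₂ e₁ e₂ e₃) ω s u₁ ∧ Conn (endsP3 ends v u₁ u₂ e₁ e₂ e₃) (compl ω) s u₃) then 0 else 1) else (if (Conn (endsP3 ends v u₁ u₂ e₁ e₂ e₃) ω s u₃ ∧ Conn (endsP3 ends v u₁ u₂ e₁ e₂ e₃) (compl ω) s u₁) then 0 else 1)) else (0 : ℕ))) = T3 at hG3 ⊢
  generalize (∑ ω : Config E, (if ω e₃ = ω e₁ ∧ ω e₁ ≠ ω e₂ then (if ω ∈ twoWorld (endsP3 ends v u₃ u₁ e₃ e₁ e₂) s A X B Y then (if ω e₃ = true then (if (Conn (endsP3 ends v u₃ u₁ e₃ e₁ e₂) ω s u₃ ∧ Conn (endsP3 ends v u₃ u₁ e₃ e₁ e₂) (compl ω) s u₂) then 0 else 1) else (if (Conn (endsP3 ends v u₃ u₁ e₃ e₁ e₂) ω s u₂ ∧ Conn (endsP3 ends v u₃ u₁ e₃ e₁ e₂) (compl ω) s u₃) then 0 else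 1)) else (0 : ℕ)) else 0)) = S2 at hG2 ⊢
  generalize (∑ ω : Config E, (if ω ∈ twoWorld (endsP3 ends v u₃ u₁ e₃ e₁ e₂) s A X B Y then (if ω e₃ = true then (if (Conn (endsP3 ends v u₃ u₁ e₃ e₁ e₂) ω s u₃ ∧ Conn (endsP3 ends v u₃ u₁ e₃ e₁ e₂) (compl ω) s u₂) then 0 else 1) else (if (Conn (endsP3 ends v u₃ u₁ e₃ e₁ e₂) ω s u₂ ∧ Conn (endsP3 ends v u₃ u₁ e₃ e₁ e₂) (compl ω) s u₃) then 0 else 1)) else (0 : ℕ))) = T2 at hG2 ⊢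
  generalize (∑ ω : Config E, (if ω e₂ = ω e₃ ∧ ω e₃ ≠ ω e₁ then (if ω ∈ twoWorld (endsP3 ends v u₂ u₃ e₂ e₃ e₁) s A X B Y then (if ω e₂ = true then (if (Conn (endsP3 ends v u₂ u₃ e₂ e₃ e₁) ω s u₂ ∧ Conn (endsP3 ends v u₂ u₃ e₂ e₃ e₁) (compl ω) s u₁) then 0 else 1) else (if (Conn (endsP3 ends v u₂ u₃ e₂ e₃ e₁) ω s u₁ ∧ Conn (endsP3 ends v u₂ u₃ e₂ e₃ e₁) (compl ω) s u₂) then 0 else 1)) else (0 : ℕ)) else 0)) = S1 at hG1 ⊢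
  generalize (∑ ω : Config E, (if ω ∈ twoWorld (endsP3 ends v u₂ u₃ e₂ e₃ e₁) s A X B Y then (if ω e₂ = true then (if (Conn (endsP3 ends v u₂ u₃ e₂ e₃ e₁) ω s u₂ ∧ Conn (endsP3 ends v u₂ u₃ e₂ e₃ e₁) (compl ω) s u₁) then 0 else 1) else (if (Conn (endsP3 ends v u₂ u₃ e₂ e₃ e₁) ω s u₁ ∧ Conn (endsP3 ends v u₂ u₃ e₂ e₃ e₁) (compl ω) s u₂) then 0 else 1)) else (0 : ℕ))) = T1 at hG1 ⊢
  generalize count (twoWorld ends s A X B Y ∩ tied {e₁, e₂, e₃}) = C0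
  omega

/-- **(CORE↓) at a vertex of degree 3 follows from the tied Harris and GENSYM3 on the three `G⁺_k`**. -/
theorem coreDown_of_genSym3 (hd : Deg3 ends v u₁ u₂ u₃ e₁ e₂ e₃) (hsv : s ≠ v) (hv : v ∉ A ∪ X ∪ B ∪ Y)
    (hXY : X ∩ Y = ∅)
    (h3 : GenSym3 (endsP3 ends v u₁ u₂ e₁ e₂ e₃) s A X B Y e₁ u₁ u₃)
    (h2 : GenSym3 (endsP3 ends v u₃ u₁ e₃ e₁ e₂) s A X B Y e₃ u₃ u₂)
    (h1 : GenSym3 (endsP3 ends v u₂ u₃ e₂ e₃ e₁) s A X B Y e₂ u₂ u₁) :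
    CoreDown ends s A X B Y {v} := by
  have hv' : v ∉ (A ∪ B) ∪ ∅ ∪ ∅ ∪ (X ∪ Y) := by
    rw [Finset.union_empty, Finset.union_empty]
    intro h
    rcases Finset.mem_union.1 h with h | h <;> rcases Finset.mem_union.1 h with h | h
    · exact hv (Finset.mem_union_left _ (Finset.mem_union_left _ (Finset.mem_union_left _ h)))
    · exact hv (Finset.mem_union_left _ (Finset.mem_union_right _ h))
    · exact hv (Finset.mem_union_left _ (Finset.mem_union_left _ (Finset.mem_union_right _ h)))
    · exact hv (Finset.mem_union_right _ h)
  have hL := four_mul_coreCount_deg3 ends s A X B Y hd hsv hv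
  have hR := four_mul_coreCount_deg3 ends s (A ∪ B) ∅ ∅ (X ∪ Y) hd hsv hv'
  have hT := count_tied_le ends s {e₁, e₂, e₃} A X B Y hXY
  unfold GenSym3 at h1 h2 h3
  unfold CoreDown
  have : 4 * coreCount ends s A X B Y {v} ≤ 4 * coreCount ends s (A ∪ B) ∅ ∅ (X ∪ Y) {v} := by
    rw [hL, hR]
    exact Nat.add_le_add (Nat.mul_le_mul_left 4 hT) (Nat.add_le_add h3 (Nat.add_le_add h2 h1))
  exact Nat.le_of_mul_le_mul_left this (by norm_num)

end Expansion

end ReimerVdBK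
end Summit.Ventures.PercRepro2
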